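import Summits.BirchSwinnertonDyer.Rank1Residual.X5.SelmerSolitaireQuadraticNormalFormLemmas
import HarnessLib

/-!
# Selmer solitaire, QUADRATIC-SPACE LAYER (ii‴) — Q6: the DESCENT RULE `descentRule_holds : DescentRule`
# (QS5, Mazur–Rubin Prop. 4.3 (ii) shape)

Cell `b2b-bsdres`, O1 programme (p = 2), ORDER v2.9 pool slot (ii‴) (o1 lead GEN 20 R-G20.3/R-G20.4,
PLAN C150; GEN 21 C157: "Q3 / Q6 / Q7 open to any idle o1-pool hand"), file Q6; pool hand x11b3-p9
GEN 3 (INTENT INBOX 2026-08-21T15:20:31Z).  Proves the word-shape QS5 `DescentRule` of Q1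
(`X5/SelmerSolitaireQuadratic.lean`, p283641) VERBATIM, by pure `𝔽₂` linear algebra.

HONEST FRAMING (cell, verbatim): research route; pure `𝔽₂` linear algebra — no curve, no Galois group,
no prime; THEOREMS ONLY (no definition, no named fact, no `sorry`); the arithmetic dictionary
(AR1–AR4: the local quadratic spaces are `(H¹(ℚ_v, E[2]), q_v)`, the Lagrangian is the localisation
image of the relaxed 2-Selmer group, a move is the adjunction of a Kolyvagin prime realising a
functional) is NOT asserted anywhere; reach-neutral (R1 closes no class); nothing booked; no mark /
label / count moved; O1 OPEN.  Executable evidence (lens-2 GEN 10/11, EVIDENCE only): 34 560 descent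
checks at |D| = 3, 2 350 080 at |D| = 4 (j134144), 0 violations.

## The statement (Q1's `DescentRule`)

For a totally singular Lagrangian `U ⊂ Q_D`, a functional `ψ`, a vertex `n ⊆ D`, and a totally
singular Lagrangian `L ⊂ Q_{D ∪ q}` containing `K′_ψ = {ι x + ψ(x)·u_q : x ∈ U}` but not `u_q`
(the forced move, QS2a): if `ψ ≠ 0` on `U ∩ Λ*_n`, then every `y ∈ L ∩ Λ*_{n ∪ q}` is `ι x` for an
`x ∈ U ∩ Λ*_n` with `ψ(x) = 0` — "the move lowers `λ*(n)` by one" (Mazur–Rubin, *Introduction to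
Kolyvagin systems*, Prop. 4.3 (ii); `dim (L ∩ Λ*_{n∪q}) = dim (U ∩ Λ*_n) − 1`).

## Proof (≈ ten lines of linear algebra)

Write `y = (m; (a, b)_q)` with `m` the old part.  `y ∈ Λ*_{n∪q}` says `m ∈ Λ*_n` and `a = 0`.
Total singularity of `L` against `K′_ψ ⊂ L` gives, for every `x ∈ U`,
`0 = polar(y, ι x + ψ(x) u_q) = polar_D(m, x) + b·ψ(x)` (§2: `polar_iota_right`, `polar_uNew_right`).
If `b = 1`, the witness `x₁ ∈ U ∩ Λ*_n` with `ψ(x₁) = 1` gives `polar_D(m, x₁) = 1`, but `Λ*_n` is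
`polar`-isotropic (§3) — contradiction; so `b = 0`, `y = ι m`, and `m ∈ U^⊥ = U` by LAGRANGIAN
MAXIMALITY (§1 `Descent.mem_of_forall_polar_eq_zero`: `polar` is a non-degenerate symmetric bilinear
form on `Q_D ≅ 𝔽₂^{2(s+1)}`, `U ≤ U^⊥` by total singularity, and `dim U^⊥ = 2(s+1) − (s+1) = dim U`,
Mathlib `LinearMap.BilinForm.finrank_orthogonal`).  Finally `ψ(m) = 0`, for otherwise
`u_q = (ι m + ψ(m) u_q) − y ∈ L`.

## Contents
* §1 `Descent.polar_*` (biadditivity, symmetry, unit vectors ⇒ non-degenerate), `Descent.finrank_qVec`,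
  **`Descent.mem_of_forall_polar_eq_zero`**
  (Lagrangian maximality; the polar form is packaged as a `LinearMap.BilinForm` by `LinearMap.mk₂`
  INSIDE the proof — no top-level definition);
* §2 `Descent.iota_apply_*`, `Descent.uNew_apply_*`, `Descent.polar_iota_right`,
  `Descent.polar_uNew_right`, `Descent.eq_iota_of_apply_last_eq_zero`;
* §3 `Descent.inLamStar_res_of_inLamStar_insert`, `Descent.polar_eq_zero_of_inLamStar`;
* §4 **`descentRule_holds : DescentRule`** (Q1's reserved name, R-G20.3).

## References
* B. Mazur, K. Rubin, *Introduction to Kolyvagin systems*, Contemp. Math. 358 (2004), Prop. 4.3 (ii)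
  [cite: MazurRubin2004Intro]; *Kolyvagin systems*, Mem. AMS 799 (2004), §4.3. [MazurRubin2004]
* B. Poonen, E. Rains, *Random maximal isotropic subspaces and Selmer groups*, JAMS 25 (2012), §2
  (quadratic spaces over `𝔽₂`, maximal isotropic = Lagrangian), §4. [PoonenRains2012]
* lens-2 GEN 5 G5.1 Prop. B/C, GEN 10 2G10.2 (QS5), GEN 11 (|D| = 4 table), `cells/o1/ROUTES-O1.md`.

## Tree search (dedup, 2026-08-21T15:20Z)
`lean search 'QuadraticDescent|descentRule_holds|Descent\.polar|finrank_qVec'` in `Summits/` → none;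
INBOX grep → lens-2 2G10.x, Q1's reserved name, o1-lead order lines, lens-2 GEN 11 only; p4 = Q2/Q4,
p3 = Q5 (`Cube.*`), p2 = Q3 (`NF.*`) — disjoint helper stems; polarisation `NF.qform_add`, isotropy
`NF.polar_eq_zero_of_mem` and `NF.zmod2_add_eq_zero_iff` are IMPORTED from x11b3-p2's landed
`X5/SelmerSolitaireQuadraticNormalFormLemmas.lean` (gate dedup), not re-proved.
-/

namespace Summit.BirchSwinnertonDyer.Rank1Residual.X5.SelmerSolitaire.Quadratic

open Finset SelmerSolitaire Module

variable {s : ℕ}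

namespace Descent

/-! ## §1 The quadratic form `Q_D`, its polar form, non-degeneracy, and Lagrangian maximality -/

/-- The polar form is symmetric. [folklore] -/
theorem polar_comm (x y : QVec s) : polar x y = polar y x := by
  unfold polar
  exact Finset.sum_congr rfl fun v _ => by ring

/-- Additivity of the polar form in the first variable. [folklore] -/
theorem polar_add_left (x x' y : QVec s) : polar (x + x') y = polar x y + polar x' y := by
  simp only [polar, Pi.add_apply, Prod.fst_add, Prod.snd_add, ← Finset.sum_add_distrib]
  exact Finset.sum_congr rfl fun v _ => by ring

/-- Homogeneity of the polar form in the first variable. [folklore] -/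
theorem polar_smul_left (c : ZMod 2) (x y : QVec s) : polar (c • x) y = c * polar x y := by
  simp only [polar, Pi.smul_apply, Prod.smul_fst, Prod.smul_snd, smul_eq_mul, Finset.mul_sum]
  exact Finset.sum_congr rfl fun v _ => by ring

/-- Additivity of the polar form in the second variable. [folklore] -/
theorem polar_add_right (x y y' : QVec s) : polar x (y + y') = polar x y + polar x y' := by
  rw [polar_comm, polar_add_left, polar_comm y, polar_comm y']

/-- Homogeneity of the polar form in the second variable. [folklore] -/
theorem polar_smul_right (c : ZMod 2) (x y : QVec s) : polar x (c • y) = c * polar x y := by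
  rw [polar_comm, polar_smul_left, polar_comm]

/-- Pairing with the unit vector `u_v = (1, 0)_v` reads the `t_v`-coordinate. [folklore] -/
theorem polar_single_fst_right (x : QVec s) (v : V s) :
    polar x (Pi.single v ((1, 0) : ZMod 2 × ZMod 2)) = (x v).2 := by
  unfold polar
  rw [Finset.sum_eq_single v]
  · simp [Pi.single_eq_same]
  · intro w _ hw
    simp [Pi.single_eq_of_ne hw]
  · intro h
    exact absurd (Finset.mem_univ v) h

/-- Pairing with the unit vector `t_v = (0, 1)_v` reads the `u_v`-coordinate. [folklore] -/
theorem polar_single_snd_right (x : QVec s) (v : V s) :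
    polar x (Pi.single v ((0, 1) : ZMod 2 × ZMod 2)) = (x v).1 := by
  unfold polar
  rw [Finset.sum_eq_single v]
  · simp [Pi.single_eq_same]
  · intro w _ hw
    simp [Pi.single_eq_of_ne hw]
  · intro h
    exact absurd (Finset.mem_univ v) h

/-- **The polar form is non-degenerate** on `Q_D` (a sum of hyperbolic planes). [cite: PoonenRains2012, §2] -/
theorem eq_zero_of_forall_polar_eq_zero (x : QVec s) (h : ∀ y, polar x y = 0) : x = 0 := by
  funext v
  refine Prod.ext ?_ ?_
  · have h1 := h (Pi.single v ((0, 1) : ZMod 2 × ZMod 2))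
    rw [polar_single_snd_right] at h1
    simpa using h1
  · have h1 := h (Pi.single v ((1, 0) : ZMod 2 × ZMod 2))
    rw [polar_single_fst_right] at h1
    simpa using h1

/-- `dim Q_D = 2(|D| + 1)` (two coordinates at each of the `s + 1` vertices of `D ⊔ {∞}`). [folklore] -/
theorem finrank_qVec (s : ℕ) : Module.finrank (ZMod 2) (QVec s) = 2 * (s + 1) := by
  rw [Module.finrank_pi_fintype (ZMod 2) (M := fun _ : V s => ZMod 2 × ZMod 2)]
  simp only [Module.finrank_prod, Module.finrank_self, Finset.sum_const, Finset.card_univ,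
    Fintype.card_option, Fintype.card_fin, smul_eq_mul]
  ring

/-- **LAGRANGIAN MAXIMALITY — `U^⊥ = U` for a totally singular Lagrangian `U`**, in the form used by
the descent rule: a vector `polar`-orthogonal to all of `U` lies in `U`.  Proof: `polar` is a
symmetric NON-DEGENERATE bilinear form on `Q_D ≅ 𝔽₂^{2(s+1)}` (packaged by `LinearMap.mk₂` inside the
proof), `U ≤ U^⊥` by total singularity, and `dim U^⊥ = dim Q_D − dim U = s + 1 = dim U`
(`LinearMap.BilinForm.finrank_orthogonal`), so `U^⊥ = U`. [cite: PoonenRains2012, §2 (maximal isotropic subspaces)] -/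
theorem mem_of_forall_polar_eq_zero {U : Submodule (ZMod 2) (QVec s)} (hU : IsTSLagrangian U)
    {m : QVec s} (hm : ∀ x ∈ U, polar m x = 0) : m ∈ U := by
  -- the polar form as a bilinear form
  let B : LinearMap.BilinForm (ZMod 2) (QVec s) :=
    LinearMap.mk₂ (ZMod 2) polar polar_add_left polar_smul_left polar_add_right polar_smul_right
  have hB : ∀ x y, B x y = polar x y := fun _ _ => rfl
  have hnd : B.Nondegenerate := by
    refine ⟨fun x hx => eq_zero_of_forall_polar_eq_zero x fun y => hx y, fun y hy => ?_⟩
    refine eq_zero_of_forall_polar_eq_zero y fun x => ?_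
    rw [polar_comm]
    exact hy x
  -- `U ≤ U^⊥` (total singularity)
  have hle : U ≤ B.orthogonal U := fun x hx => by
    rw [LinearMap.BilinForm.mem_orthogonal_iff]
    intro n hn
    rw [hB]
    exact NF.polar_eq_zero_of_mem hU.1 hn hx
  -- `dim U^⊥ = 2(s+1) − (s+1) = dim U`
  have horth : Module.finrank (ZMod 2) (B.orthogonal U) = s + 1 := by
    rw [LinearMap.BilinForm.finrank_orthogonal hnd, finrank_qVec, hU.2]
    omega
  have heq : U = B.orthogonal U :=
    Submodule.eq_of_le_of_finrank_eq hle (by rw [horth, hU.2])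
  rw [heq, LinearMap.BilinForm.mem_orthogonal_iff]
  intro x hx
  rw [hB, polar_comm]
  exact hm x hx

/-! ## §2 The embedding `ι : Q_D ↪ Q_{D ∪ q}`, the vector `u_q`, and the old part of a vector -/

/-- `ι` is the identity at `∞`. [folklore] -/
@[simp] theorem iota_apply_none (x : QVec s) : iota x none = x none := rfl

/-- `ι` copies the old vertices. [folklore] -/
@[simp] theorem iota_apply_castSucc (x : QVec s) (i : Fin s) :
    iota x (some (Fin.castSucc i)) = x (some i) := by
  simp [iota, Fin.lastCases_castSucc]

/-- `ι` vanishes at the new vertex `q`. [folklore] -/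
@[simp] theorem iota_apply_last (x : QVec s) : iota x (some (Fin.last s)) = 0 := by
  simp only [iota, Fin.lastCases_last]
  rfl

/-- `u_q` at the new vertex is the unramified unit vector `(1, 0)`. [folklore] -/
@[simp] theorem uNew_apply_last : uNew s (some (Fin.last s)) = (1, 0) := by
  simp [uNew]

/-- `u_q` vanishes away from the new vertex. [folklore] -/
theorem uNew_apply_of_ne {v : V (s + 1)} (hv : v ≠ some (Fin.last s)) : uNew s v = 0 := by
  simp [uNew, Pi.single_eq_of_ne hv]

/-- **Pairing against `ι x` only sees the old part**: `polar(y, ι x) = polar_D(y|_D, x)`, where the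
old part `y|_D` is `y ∘ oldV`. [folklore] -/
theorem polar_iota_right (y : QVec (s + 1)) (x : QVec s) :
    polar y (iota x) = polar (fun v => y (oldV v)) x := by
  unfold polar
  rw [Fintype.sum_option, Fintype.sum_option, Fin.sum_univ_castSucc]
  simp only [iota_apply_none, iota_apply_castSucc, iota_apply_last, Prod.fst_zero, Prod.snd_zero,
    mul_zero, add_zero]
  rfl

/-- **Pairing against `u_q` reads the `t_q`-coordinate**: `polar(y, u_q) = y_q.2`. [folklore] -/
theorem polar_uNew_right (y : QVec (s + 1)) : polar y (uNew s) = (y (some (Fin.last s))).2 := by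
  unfold polar
  rw [Finset.sum_eq_single (some (Fin.last s))]
  · simp [uNew_apply_last]
  · intro v _ hv
    simp [uNew_apply_of_ne hv]
  · intro h
    exact absurd (Finset.mem_univ _) h

/-- A vector of `Q_{D ∪ q}` vanishing at `q` is `ι` of its old part. [folklore] -/
theorem eq_iota_of_apply_last_eq_zero (y : QVec (s + 1)) (h : y (some (Fin.last s)) = 0) :
    y = iota (fun v => y (oldV v)) := by
  funext v
  rcases v with _ | l
  · rfl
  · induction l using Fin.lastCases with
    | last => rw [iota_apply_last]; exact h
    | cast i => rw [iota_apply_castSucc]; rfl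

/-! ## §3 The strict conditions `Λ*_n` under `ι`, and their isotropy -/

/-- **`y ∈ Λ*_{n ∪ q}` ⟹ the old part of `y` is in `Λ*_n` and the `u_q`-coordinate of `y` vanishes.**
(`Λ*_{n∪q}`: zero at `∞`; transverse coordinate only at the primes of `n ∪ {q}`; unramified
coordinate only elsewhere.) [cite: MazurRubin2004Intro, Def. 4.2] -/
theorem inLamStar_res_of_inLamStar_insert (n : Finset (Fin s)) (y : QVec (s + 1))
    (hy : InLamStar (insert (Fin.last s) (lift n)) y) :
    InLamStar n (fun v => y (oldV v)) ∧ (y (some (Fin.last s))).1 = 0 := by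
  obtain ⟨h0, hΛ⟩ := hy
  refine ⟨⟨h0, fun i => ?_⟩, (hΛ (Fin.last s)).1 (Finset.mem_insert_self _ _)⟩
  have hmem : Fin.castSucc i ∈ insert (Fin.last s) (lift n) ↔ i ∈ n := by
    rw [Finset.mem_insert, lift]
    constructor
    · rintro (h | h)
      · exact absurd h (Fin.castSucc_lt_last i).ne
      · rw [Finset.mem_map] at h
        obtain ⟨j, hj, hji⟩ := h
        rwa [← Fin.castSucc_injective s hji]
    · intro h
      exact Or.inr (Finset.mem_map_of_mem _ h)
  obtain ⟨h1, h2⟩ := hΛ (Fin.castSucc i)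
  exact ⟨fun hi => h1 (hmem.2 hi), fun hi => h2 fun h => hi (hmem.1 h)⟩

/-- **`Λ*_n` is isotropic for the polar form**: two vectors of `Λ*_n` pair to zero (at each vertex both
have the same vanishing coordinate; both vanish at `∞`). [cite: MazurRubin2004Intro, Def. 4.2] -/
theorem polar_eq_zero_of_inLamStar {n : Finset (Fin s)} {x y : QVec s} (hx : InLamStar n x)
    (hy : InLamStar n y) : polar x y = 0 := by
  unfold polar
  refine Finset.sum_eq_zero fun v _ => ?_
  rcases v with _ | i
  · rw [hx.1, hy.1]
    simp
  · by_cases hi : i ∈ n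
    · rw [(hx.2 i).1 hi, (hy.2 i).1 hi]
      ring
    · rw [(hx.2 i).2 hi, (hy.2 i).2 hi]
      ring

end Descent

/-! ## §4 THE DESCENT RULE -/

/-- **QS5 — THE DESCENT RULE (Mazur–Rubin Prop. 4.3 (ii) shape), PROVED**: for a totally singular
Lagrangian `U` of `Q_D`, a linear functional `ψ`, a vertex `n`, and a totally singular Lagrangian `L`
of `Q_{D ∪ q}` containing `K′_ψ = {ι x + ψ(x)·u_q}` and not containing `u_q` (the forced move), if
`ψ ≠ 0` on `U ∩ Λ*_n` then every `y ∈ L ∩ Λ*_{n ∪ q}` is `ι x` for an `x ∈ U ∩ Λ*_n` with `ψ(x) = 0`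
(so `dim (L ∩ Λ*_{n∪q}) = dim (U ∩ Λ*_n) − 1`: a move through a prime whose functional is non-zero on
`U ∩ Λ*_n` LOWERS `λ*`).  Proof: with `m` the old part of `y` and `b` its `t_q`-coordinate, total
singularity of `L` against `K′_ψ` gives `polar(m, x) = b·ψ(x)` on `U`; the witness `x₁ ∈ U ∩ Λ*_n`,
`ψ(x₁) = 1` and the isotropy of `Λ*_n` force `b = 0`; then `y = ι m`, `m ∈ U^⊥ = U` (Lagrangian
maximality, `Descent.mem_of_forall_polar_eq_zero`), and `ψ(m) = 0` lest `u_q ∈ L`.  Pure `𝔽₂` linear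
algebra; nothing arithmetic asserted; reach-neutral; O1 OPEN.
[cite: MazurRubin2004Intro, Prop. 4.3 (ii)] [cite: PoonenRains2012, §2] -/
theorem descentRule_holds : DescentRule := by
  intro s U ψ n L hU hL hK huq hψ y hyL hyΛ
  obtain ⟨x₁, hx₁U, hx₁Λ, hψx₁⟩ := hψ
  have h01 : ∀ a : ZMod 2, a ≠ 0 → a = 1 := by decide
  -- the old part `m` of `y` and its coordinates at `q`
  obtain ⟨hm, hy1⟩ := Descent.inLamStar_res_of_inLamStar_insert n y hyΛ
  set m : QVec s := fun v => y (oldV v) with hmdef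
  -- (∗) `polar(m, x) = b · ψ(x)` for `x ∈ U`, from `polar(y, ι x + ψ(x) u_q) = 0`
  have hstar : ∀ x ∈ U, polar m x = (y (some (Fin.last s))).2 * ψ x := by
    intro x hx
    have hk : iota x + ψ x • uNew s ∈ L := hK ⟨x, hx, rfl⟩
    have h0 : polar y (iota x + ψ x • uNew s) = 0 := NF.polar_eq_zero_of_mem hL.1 hyL hk
    rw [Descent.polar_add_right, Descent.polar_smul_right, Descent.polar_iota_right,
      Descent.polar_uNew_right] at h0
    rw [NF.zmod2_add_eq_zero_iff.mp h0, mul_comm]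
  -- `b = 0`: otherwise the witness `x₁` pairs non-trivially with `m` inside the isotropic `Λ*_n`
  have hb : (y (some (Fin.last s))).2 = 0 := by
    by_contra hb
    have h1 := hstar x₁ hx₁U
    rw [Descent.polar_eq_zero_of_inLamStar hm hx₁Λ, h01 _ hb, one_mul] at h1
    exact hψx₁ h1.symm
  -- `y = ι m`
  have hy : y = iota m := Descent.eq_iota_of_apply_last_eq_zero y (Prod.ext hy1 hb)
  -- `m ∈ U` by Lagrangian maximality
  have hmU : m ∈ U :=
    Descent.mem_of_forall_polar_eq_zero hU fun x hx => by rw [hstar x hx, hb, zero_mul]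
  -- `ψ m = 0`, for otherwise `u_q = (ι m + ψ(m) u_q) - y ∈ L`
  have hψm : ψ m = 0 := by
    by_contra h
    have hk : iota m + ψ m • uNew s ∈ L := hK ⟨m, hmU, rfl⟩
    rw [h01 _ h, one_smul, ← hy] at hk
    exact huq ((Submodule.add_mem_iff_right L hyL).mp hk)
  exact ⟨m, hmU, hm, hψm, hy⟩

end Summit.BirchSwinnertonDyer.Rank1Residual.X5.SelmerSolitaire.Quadratic
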